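import Literature.AlgebraicGeometry.Motives.GrassmannianClassifyQuotient
import Literature.AlgebraicGeometry.Morphisms.CohAffineExactness
import Literature.AlgebraicGeometry.Modules.PullbackUnitSections
import HarnessLib

/-!
# The classifying morphism `T ⟶ Gr` of a rank-`k` quotient `P ↠ Q` of a globally framed module

Topic `AlgebraicGeometry/Motives`; namespace `Literature.AlgebraicGeometry.Motives.Grassmannian`.  THEOREMS ONLY
(no definition, no instance, no notation, no named fact, no `sorry`); sequel of ★ (Q2) `GrassmannianClassifyQuotient`
(`sectionsMap`, `existsUnique_hom_ker_sectionsMap`), whose hypothesis «the sections maps `θ_V : Γ(T, V) ⊗ M → Γ(Q, V)`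
are surjective on affine opens» is discharged here from an EPIMORPHISM of `𝒪_T`-modules:

* **`sectionsMap_surjective_of_epi`** — for a global frame `e : 𝒪^J ≅ P|_T` (`J` finite, `b : Basis J ℤ M`) and an
  epimorphism `φ : P ↠ Q` between affine-localizing (e.g. quasi-coherent) modules, the sections maps of the global
  sections `q_j := φ(e_j)` are surjective on every affine open `U` ([Hartshorne1977, II Prop. 5.6]: `φ_U` is onto, ★
  `Morphisms.app_surjective_of_epi`; every section of `P` over `U` is a combination of the restricted frame, ★
  `eq_sum_coord_smul` / `basisSection_restrictTrivialisation`);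
* `nonempty_free_iso_free_over` — `𝒪_T^J` is framed over every open (restriction is a left adjoint, ★ `overAdj`; Mathlib
  `SheafOfModules.mapFreeIso`);
* **`existsUnique_hom_of_epi`** — hence for `Q` of constant rank `k` (★ `HasRank`) A UNIQUE `f : T ⟶ grassmannianScheme M k`
  with `evalAffine V (pointsEquiv f) = ker (Γ(T, V) ⊗ M → Γ(Q, V))` on all affine opens: the morphism classifying the
  quotient `𝒪_T ⊗ M ≅ P ↠ Q` ([GortzWedhorn2020, (8.4) (pp. 213–215)], the universal property of `Grass`).

Cell `hodgecm-mathlib` (D-0151), F-DAG hand (h4) «Grassmannian as a scheme» (B-p21 lineage), brick (Q2b); count-neutral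
Mathlib-side capital.  Nothing here is about HC; HC_CM is proved only modulo the 7 printed citations until rung 0 closes.

## References
* [GortzWedhorn2020] U. Görtz, T. Wedhorn, *Algebraic Geometry I*, 2nd ed. (2020), (8.4) (pp. 213–215).
* [Hartshorne1977] R. Hartshorne, *Algebraic Geometry* (1977), II Prop. 5.6 (p. 113).
* [StacksProject] The Stacks project, Tag 089R (Grassmannians).
-/

noncomputable section

-- `TopCat.Presheaf`/`Scheme.Modules` are not reducible (as in Mathlib's `AlgebraicGeometry/Modules/Tilde.lean`).
set_option backward.isDefEq.respectTransparency false

namespace Literature.AlgebraicGeometry.Motives.Grassmannian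

open CategoryTheory Opposite TensorProduct TopologicalSpace _root_.AlgebraicGeometry
open Literature.AlgebraicGeometry.Modules

universe u

variable {M : Type u} [AddCommGroup M] {k : ℕ} {J : Type u} (b : Module.Basis J ℤ M)
variable {T : Scheme.{u}} (Q : T.Modules)

/-! ## (Q2b) From an epimorphism `P ↠ Q` with `P` globally framed -/

section Epi

variable [Fintype J] {P : T.Modules} (e : SheafOfModules.free J ≅ P.over (⊤ : T.Opens)) (φ : P ⟶ Q) [Epi φ]

/-- **The sections maps of an epimorphism from a globally framed module are surjective on affine opens**: for a frame
`e : 𝒪^J ≅ P|_T` of `P` and an epimorphism `φ : P ↠ Q` of affine-localizing (e.g. quasi-coherent) modules, the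
sections maps `θ_U : Γ(T, U) ⊗ M → Γ(Q, U)` of the global sections `q_j := φ(e_j)` are surjective for every affine open
`U` — `φ_U` is surjective ([Hartshorne1977, II Prop. 5.6], ★ `Morphisms.app_surjective_of_epi`) and every section of `P`
over `U` is a combination of the restricted frame (★ `eq_sum_coord_smul`, ★ `basisSection_restrictTrivialisation`).
[cite: Hartshorne1977, II Prop. 5.6 (p. 113)] [cite: GortzWedhorn2020, (8.4) (pp. 213–215)] -/
theorem sectionsMap_surjective_of_epi (hP : IsAffineLocalizing P) (hQ : IsAffineLocalizing Q) {U : T.Opens}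
    (hU : IsAffineOpen U) :
    Function.Surjective (sectionsMap b Q (fun j => φ.app ⊤ (basisSection e j)) U) := by
  classical
  intro y
  obtain ⟨x, rfl⟩ := Morphisms.app_surjective_of_epi φ hP hQ hU y
  -- expand `x` in the restricted frame
  have hx := eq_sum_coord_smul (SheafOfModules.restrictTrivialisation (R := T.ringCatSheaf) (homOfLE le_top) e) (𝟙 U) x
  refine ⟨∑ j, coord (SheafOfModules.restrictTrivialisation (R := T.ringCatSheaf) (homOfLE le_top) e) (𝟙 U) x j ⊗ₜ[ℤ]
    b j, ?_⟩
  rw [map_sum]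
  conv_rhs => rw [hx, map_sum]
  refine Finset.sum_congr rfl fun j _ => ?_
  rw [sectionsMap_tmul, sectionsMap_one_tmul, Scheme.Modules.Hom.app_smul, op_id, P.presheaf.map_id,
    CategoryTheory.id_apply, basisSection_restrictTrivialisation, Scheme.Modules.Hom.app_map_apply]

/-- **The free module `𝒪_T^J` is globally framed** (`𝒪^J ≅ 𝒪^J|_U` over any open `U`: restriction to the opens over `U`
preserves coproducts, being a left adjoint (★ `overAdj`), and the unit, Mathlib `SheafOfModules.mapFreeIso`).
[cite: GortzWedhorn2020, (8.4) (pp. 213–215)] -/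
theorem nonempty_free_iso_free_over (U : T.Opens) :
    Nonempty (SheafOfModules.free J ≅ (SheafOfModules.free J : T.Modules).over U) := by
  haveI := (overAdj (X := T) U).leftAdjoint_preservesColimits
  exact ⟨SheafOfModules.mapFreeIso (Scheme.Modules.overFunctor (X := T) U) J (Iso.refl _)⟩

variable (M k) [(grassmannianSheaf M k).obj.IsRepresentable]

/-- **The classifying morphism of a rank-`k` quotient `φ : P ↠ Q` of a globally framed module `P ≅ 𝒪_T ⊗ M`**
(`e : 𝒪^J ≅ P|_T`, `b : Basis J ℤ M`; e.g. `P = 𝒪_T^J` by `nonempty_free_iso_free_over`): there is a UNIQUE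
`f : T ⟶ grassmannianScheme M k` with `evalAffine V (pointsEquiv f) = ker (Γ(T, V) ⊗ M → Γ(Q, V))` for every affine
open `V` — ★ `existsUnique_hom_ker_sectionsMap` fed by `sectionsMap_surjective_of_epi`.
[cite: GortzWedhorn2020, (8.4) (pp. 213–215)] [cite: StacksProject, Tag 089R] -/
theorem existsUnique_hom_of_epi (hP : IsAffineLocalizing P) (hQ : HasRank Q k) :
    ∃! f : T ⟶ grassmannianScheme M k, ∀ V : T.affineOpens,
      (evalAffine V.2 (pointsEquiv M k T f)).toSubmodule =
        LinearMap.ker (sectionsMap b Q (fun j => φ.app ⊤ (basisSection e j)) V) := by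
  obtain ⟨F, -⟩ := exists_frameSystem_of_hasRank hQ
  exact existsUnique_hom_ker_sectionsMap M k b Q _ hQ fun W hW =>
    sectionsMap_surjective_of_epi b Q e φ hP (isAffineLocalizing_of_isFiniteLocallyFree F.isFiniteLocallyFree) hW

end Epi

end Literature.AlgebraicGeometry.Motives.Grassmannian

end
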